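import Summits.BirchSwinnertonDyer.BirchSwinnertonDyer.Theorems.PrintCf2SplitBadTwoRestrictedSelmerPairSkeleton
import Literature.NumberTheory.EllipticCurves.IwasawaSelmerControlKernelProofs
import Literature.NumberTheory.EllipticCurves.IwasawaSelmerControlCokerProofs
import HarnessLib

/-!
# Crux `PrintCf2.SplitBadTwoRankOneOfFacts` (stmt-BirchSwinnertonDyer-20368), road α — brick B5′:
# CONTROL SKELETON for Agboola's restricted Selmer groups along a `ℤ_p`-line (generic coefficient module)

Cell `bsd-print-cf2`, width seat `bsd-line-cf2-p1-w7` g0 (CLAIM on HOME/STATUS 2026-08-28T16:5xZ, outside the planner's B1–B9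
menu: the MIDDLE step of road α's S3b descent, between the LEAD's `Agboola2007.RestrictedDualData` at the top of the
`ℤ₂`-line and this seat's bottom pair skeleton `Theorems/PrintCf2SplitBadTwoRestrictedSelmerPair{Skeleton,Base}.lean`,
p648601 / p649193); `--supports stmt-BirchSwinnertonDyer-20368` (helper, Theses-free). HONEST FRAMING: nothing here
closes a crux or a stub; BSD is not proved by any of this; no summit statement is proved by this seat. No
definition, no named fact, no `sorry`.

Agboola 2007 Prop. 3.2 is "a `control theorem' for restricted Selmer groups" along the one-prime-ramified
`ℤ_p`-extension (printed for `p > 3`, good ordinary CM `E`). This file proves its KERNEL-LEVEL SKELETON for an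
ARBITRARY discrete `Γ_K`-module `M`, ANY `ℤ_p`-extension `κ` of a number field `K` (layers `H_n = κ.layerSubgroup n =
Gal(K̄/K_n) ≥ H_∞ = ker κ`; the bottom is `n = 0`, `H_0 = ⊤`) and ANY place `𝔮`, with every local term an ABSTRACT local
kernel (no local computation; the values are local theory — bricks B2/B7 — and Agboola §§5–8):
* §1 `resOfLe_mem_restrictedSelmer`, `map_resOfLe_restrictedSelmer_le`, `conjH1_resOfLe_eq_of_mem`: restriction along
  normal `H ≤ H′ ≤ Γ_K` carries `𝔖_𝔮(K̄^{H′}, M)` into `𝔖_𝔮(K̄^{H}, M)^{H′/H}` (all conditions of `𝔖_𝔮` are vanishing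
  restrictions, file 1 `mem_restrictedSelmer_iff_resOfLe`);
* §2 the CONTROL MAP `𝔖_𝔮(K_n, M) → 𝔖_𝔮(K_∞, M)^{Γ_n}` (`resOfLe_mem_restrictedSelmer_kerSubgroup`), its KERNEL
  `= 𝔖_𝔮(K_n, M) ∩ ker (H¹(K_n, M) → H¹(K_∞, M))` (`ker_resOfLe_comp_subtype_restrictedSelmer`), FINITE with
  `# ≤ #(M^{H_∞} ⧸ (γ^{pⁿ} − 1))` for `M` with continuous orbit maps (`finite_ker_resOfLe_and_card_le` = Greenberg's
  Lemma 3.1 for generic `M`, adapted from the tree's `E[p^∞]` proof onto `ResKernel.finite_subgroupResKer`;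
  `finite_ker_control_and_card_le`); its COKERNEL IS LOCAL: every `γ^{pⁿ}`-invariant class of `H¹(K_∞, M)` lifts to
  `H¹(K_n, M)` for `p`-primary `M` (`exists_resOfLe_eq_of_conjH1_eq` = the tree's generic Lemma 3.2
  `ZpExtension.mem_range_resOfLe_of_conjH1_eq`), and the lift's level-`n` local classes lie in the LOCAL KERNELS
  `ker (H¹(H_n ⊓ D_w, M) → H¹(H_∞ ⊓ D_w, M))` (`resOfLe_local_lift_eq_zero`), whence the image description
  `mem_map_resOfLe_restrictedSelmer_iff` and the surjectivity criterion `control_surjective_of_local`;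
* the bottom `n = 0`: `𝔖_𝔮(K_0, M)` IS `Agboola2007.restrictedSelmerBase M p 𝔮` transported along the invertible
  restriction `H¹(⊤, M) → H¹(H_0, M)` (`map_resOfLe_restrictedSelmerBase_eq_layer_zero`,
  `card_restrictedSelmer_layer_zero_eq`).
For road α: `K = K₀ = ℚ(√−7)`, `p = 2`, `κ` = the `ℤ₂`-line of record (K*_∞, unramified outside `𝔭̄₀`, or the
anticyclotomic line), `M = W* = ↥((W.baseChange K₀).endEigenPrimaryTorsion 2 π r)` (p646843: discrete, `2`-primary;
continuity of its orbit maps is the restriction of the tree's `continuous_smul_geomPrimaryTorsion`), `𝔮 = 𝔭̄₀`.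

NOT PROVED HERE: the values of the local kernels and of `M^{H_∞}/(γ^{pⁿ} − 1)` (for `W*`: `W*(K_∞)` and the local
points), the `Λ`-module packaging of `𝔖_𝔮(K_∞, M)^∨` (LEAD g10's `RestrictedDualData`), and the passage from control
to characteristic ideals / orders (Agboola §§5–8). presearch: not applicable (no stub, no fact filed; Greenberg LNM 1716
§3 Lemmas 3.1–3.2, Agboola 2007 Prop. 3.2, Neukirch–Schmidt–Wingberg I §5–6).

References: A. Agboola, Compositio Math. 143 (2007) = arXiv:math/0602192, §3 Prop. 3.2, §6 [Agboola2007]; R. Greenberg,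
LNM 1716 (1999) §3 Lemmas 3.1–3.2 [GreenbergLNM1716]; J.-P. Serre, *Local Fields*, VII §5 Prop. 3 [SerreLocalFields1979];
J. Neukirch, A. Schmidt, K. Wingberg, *Cohomology of Number Fields* (2008) I §5–6 [NeukirchSchmidtWingberg2008].
-/

noncomputable section

open scoped Classical

set_option linter.dupNamespace false
set_option autoImplicit false

open NumberField IsDedekindDomain Field
open Literature.NumberTheory.EllipticCurves Literature.NumberTheory.EllipticCurves.GreenbergSelmer
open Literature.NumberTheory.EllipticCurves.Castella2018.AcSelmer
open Literature.NumberTheory.EllipticCurves.Agboola2007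
open Literature.NumberTheory.GaloisRepresentations
open Literature.NumberTheory.EllipticCurves.ResKernel

universe u

namespace Summit.BirchSwinnertonDyer.BirchSwinnertonDyer.Theorems.PrintCf2.RestrictedSelmerPair

/-! ## §1. Restriction functoriality: `𝔖_𝔮(K̄^{H′}, M) → 𝔖_𝔮(K̄^{H}, M)` for normal `H ≤ H′` -/

section Restriction

variable {K : Type u} [Field K] [NumberField K]
  {H H' : Subgroup (absoluteGaloisGroup K)} [H.Normal] [H'.Normal]
  (M : Type u) [AddCommGroup M] [DistribMulAction (absoluteGaloisGroup K) M]
  [TopologicalSpace M] [DiscreteTopology M] (p : ℕ) (𝔮 : HeightOneSpectrum (𝓞 K))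

omit [NumberField K] [H.Normal] [H'.Normal] in
/-- Restriction to `H ⊓ D` through `H` equals restriction through `H′ ⊓ D` (both are the restriction
`H¹(H′, M) → H¹(H ⊓ D, M)`, `resOfLe_comp`). [cite: NeukirchSchmidtWingberg2008, I.§5] -/
theorem resOfLe_inf_resOfLe (h : H ≤ H') (D : Subgroup (absoluteGaloisGroup K)) (x : subgroupH1 H' M) :
    resOfLe M (inf_le_left : H ⊓ D ≤ H) (resOfLe M h x) =
      resOfLe M (inf_le_inf_right D h : H ⊓ D ≤ H' ⊓ D) (resOfLe M (inf_le_left : H' ⊓ D ≤ H') x) := by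
  rw [← AddMonoidHom.comp_apply, ← AddMonoidHom.comp_apply, resOfLe_comp_holds, resOfLe_comp_holds]

/-- **Restriction carries `𝔖_𝔮(K̄^{H′}, M)` into `𝔖_𝔮(K̄^{H}, M)`** for normal subgroups `H ≤ H′` of `Γ_K` (the
restriction maps of Agboola's control theorem, Prop. 3.2; Greenberg's maps `s_n`): every condition of `𝔖_𝔮` is the
vanishing of a restriction of a conjugate (`mem_restrictedSelmer_iff_resOfLe`, file 1), conjugation commutes with
restriction (`resOfLe_comp_conjH1`) and restrictions compose (`resOfLe_inf_resOfLe`).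
[cite: Agboola2007, §3 Prop. 3.2 (arXiv p0008:L128–135)] [cite: GreenbergLNM1716, §1 Thm. 1.2 (the maps `s_n`)] -/
theorem resOfLe_mem_restrictedSelmer (h : H ≤ H') {c : subgroupH1 H' M}
    (hc : c ∈ restrictedSelmer H' M p 𝔮) : resOfLe M h c ∈ restrictedSelmer H M p 𝔮 := by
  rw [mem_restrictedSelmer_iff_resOfLe] at hc ⊢
  have hcomm : ∀ σ : absoluteGaloisGroup K,
      conjH1 H M σ (resOfLe M h c) = resOfLe M h (conjH1 H' M σ c) :=
    fun σ ↦ (congrArg (fun f ↦ f c) (resOfLe_comp_conjH1_holds (M := M) h σ)).symm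
  refine ⟨fun w hw σ ↦ ?_, fun w σ ↦ ?_, fun σ ↦ ?_⟩
  · rw [hcomm, resOfLe_inf_resOfLe M h, hc.1 w hw σ, map_zero]
  · rw [hcomm, resOfLe_inf_resOfLe M h, hc.2.1 w σ, map_zero]
  · rw [hcomm, resOfLe_inf_resOfLe M h, hc.2.2 σ, map_zero]

/-- Subgroup form of `resOfLe_mem_restrictedSelmer`: `res(𝔖_𝔮(K̄^{H′}, M)) ≤ 𝔖_𝔮(K̄^{H}, M)`.
[cite: Agboola2007, §3 Prop. 3.2 (arXiv p0008:L128–135)] -/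
theorem map_resOfLe_restrictedSelmer_le (h : H ≤ H') :
    (restrictedSelmer H' M p 𝔮).map (resOfLe M h) ≤ restrictedSelmer H M p 𝔮 := by
  rintro _ ⟨c, hc, rfl⟩
  exact resOfLe_mem_restrictedSelmer M p 𝔮 h hc

omit [NumberField K] in
/-- **The image of restriction is invariant**: a class restricted from `H′` is fixed by `conj_σ` for every `σ ∈ H′`
(`conjH1_resOfLe_of_mem`: inner automorphisms act trivially on `H¹(H′, M)`), so `res(𝔖_𝔮(K̄^{H′}, M))` lies in
`𝔖_𝔮(K̄^{H}, M)^{H′/H}`. [cite: SerreLocalFields1979, VII.§5 Prop. 3] [cite: NeukirchSchmidtWingberg2008, I.§5] -/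
theorem conjH1_resOfLe_eq_of_mem (h : H ≤ H') {σ : absoluteGaloisGroup K} (hσ : σ ∈ H')
    (c : subgroupH1 H' M) : conjH1 H M σ (resOfLe M h c) = resOfLe M h c :=
  conjH1_resOfLe_of_mem M h hσ c

end Restriction

/-! ## §2. The control map along a `ℤ_p`-line at layer `n`: `𝔖_𝔮(K_n, M) → 𝔖_𝔮(K_∞, M)^{Γ_n}` -/

section Control

variable {K : Type u} [Field K] [NumberField K] {p : ℕ} [Fact p.Prime] (κ : ZpExtension K p)
  (M : Type u) [AddCommGroup M] [DistribMulAction (absoluteGaloisGroup K) M]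
  [TopologicalSpace M] [DiscreteTopology M] (𝔮 : HeightOneSpectrum (𝓞 K)) (n : ℕ)

/-- **The control map at layer `n`**: restriction `H¹(K_n, M) → H¹(K_∞, M)` (`H_n = κ.layerSubgroup n ≥ ker κ = H_∞`;
`n = 0` is the bottom `H_0 = ⊤`, `ZpExtension.layerSubgroup_zero`) carries `𝔖_𝔮(K_n, M)` into the `Γ_n`-invariants of
`𝔖_𝔮(K_∞, M)` — the map whose kernel and cokernel Agboola's Prop. 3.2 controls ("a `control theorem' for restricted
Selmer groups"). [cite: Agboola2007, §3 Prop. 3.2 (arXiv p0008:L128–135)] [cite: GreenbergLNM1716, §3 (the maps `s_n`)] -/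
theorem resOfLe_mem_restrictedSelmer_kerSubgroup {c : subgroupH1 (κ.layerSubgroup n) M}
    (hc : c ∈ restrictedSelmer (κ.layerSubgroup n) M p 𝔮) :
    resOfLe M (κ.kerSubgroup_le_layerSubgroup n) c ∈ restrictedSelmer κ.kerSubgroup M p 𝔮 ∧
      ∀ σ ∈ κ.layerSubgroup n,
        conjH1 κ.kerSubgroup M σ (resOfLe M (κ.kerSubgroup_le_layerSubgroup n) c) =
          resOfLe M (κ.kerSubgroup_le_layerSubgroup n) c :=
  ⟨resOfLe_mem_restrictedSelmer M p 𝔮 _ hc,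
    fun _ hσ ↦ conjH1_resOfLe_of_mem M (κ.kerSubgroup_le_layerSubgroup n) hσ c⟩

/-! ### Kernel -/

/-- **The kernel of the control map is `𝔖_𝔮(K_n, M) ∩ ker (H¹(K_n, M) → H¹(K_∞, M))`** (as a subgroup of
`𝔖_𝔮(K_n, M)`): it is controlled by the kernel of the GLOBAL restriction map alone.
[cite: Agboola2007, §3 Prop. 3.2] [cite: GreenbergLNM1716, §3 Lemma 3.1] -/
theorem ker_resOfLe_comp_subtype_restrictedSelmer :
    ((resOfLe M (κ.kerSubgroup_le_layerSubgroup n)).comp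
        (restrictedSelmer (κ.layerSubgroup n) M p 𝔮).subtype).ker =
      ((resOfLe M (κ.kerSubgroup_le_layerSubgroup n)).ker ⊓
        restrictedSelmer (κ.layerSubgroup n) M p 𝔮).addSubgroupOf
        (restrictedSelmer (κ.layerSubgroup n) M p 𝔮) := by
  ext c
  rw [AddMonoidHom.mem_ker, AddMonoidHom.comp_apply, AddSubgroup.mem_addSubgroupOf,
    AddSubgroup.mem_inf, AddSubgroup.coe_subtype, AddMonoidHom.mem_ker]
  exact ⟨fun h ↦ ⟨h, c.2⟩, fun h ↦ h.1⟩

/-- **Greenberg's Lemma 3.1 for an ARBITRARY discrete `Γ_K`-module with continuous orbit maps**: the kernel of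
`H¹(K_n, M) → H¹(K_∞, M)` is finite with `# ≤ #(M^{H_∞} ⧸ (γ^{pⁿ} − 1) M^{H_∞})` whenever the latter is finite
(`ker ≅ H¹(Γ_n, M^{H_∞}) ↪ M^{H_∞}/(γ^{pⁿ} − 1)`; the tree's generic embedding `ResKernel.finite_subgroupResKer` on
`H_n`, topologically generated by `ker κ` and `γ^{pⁿ}`, `ZpExtension.layerSubgroup_eq_top_of_isOpen`). Adapted
verbatim from the tree's `WeierstrassCurve.finite_ker_layerToInfty_and_card_le` (the case `M = E[p^∞]`), the
continuity of the orbit maps now a hypothesis. [cite: GreenbergLNM1716, §3 Lemma 3.1 (p. 86)] -/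
theorem finite_ker_resOfLe_and_card_le {γ : absoluteGaloisGroup K} (hγ : κ.IsTopGenerator γ)
    (hcont : ∀ m : M, Continuous fun g : absoluteGaloisGroup K ↦ g • m)
    [Finite (FixedPoints.addSubgroup κ.kerSubgroup M ⧸
      (subOne κ.kerSubgroup M (γ ^ p ^ n)).range)] :
    Finite (resOfLe M (κ.kerSubgroup_le_layerSubgroup n)).ker ∧
      Nat.card (resOfLe M (κ.kerSubgroup_le_layerSubgroup n)).ker ≤
        Nat.card (FixedPoints.addSubgroup κ.kerSubgroup M ⧸
          (subOne κ.kerSubgroup M (γ ^ p ^ n)).range) := by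
  -- adapted from `WeierstrassCurve.finite_ker_layerToInfty_and_card_le` (tree, `M = E[p^∞]`), generic `M`
  let Hn : Subgroup (absoluteGaloisGroup K) := κ.layerSubgroup n
  let N : Subgroup Hn := κ.kerSubgroup.subgroupOf Hn
  let γn : Hn := ⟨γ ^ p ^ n, κ.pow_mem_layerSubgroup hγ n⟩
  have hgen : ∀ U : Subgroup Hn, IsOpen (U : Set Hn) → N ≤ U → γn ∈ U → U = ⊤ :=
    fun U hU hNU hγU ↦ κ.layerSubgroup_eq_top_of_isOpen hγ n U hU hNU hγU
  have hcont' : ∀ m : M, Continuous fun g : Hn ↦ g • m := fun m ↦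
    (hcont m).comp continuous_subtype_val
  have hfix : FixedPoints.addSubgroup N M = FixedPoints.addSubgroup κ.kerSubgroup M := by
    ext m
    simp only [FixedPoints.mem_addSubgroup]
    constructor
    · intro h τ
      exact h ⟨⟨τ, κ.kerSubgroup_le_layerSubgroup n τ.2⟩, Subgroup.mem_subgroupOf.mpr τ.2⟩
    · intro h x
      exact h ⟨((x : Hn) : absoluteGaloisGroup K), Subgroup.mem_subgroupOf.mp x.2⟩
  let e : FixedPoints.addSubgroup N M ≃+ FixedPoints.addSubgroup κ.kerSubgroup M :=
    AddEquiv.addSubgroupCongr hfix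
  have he : AddSubgroup.map
      (e : FixedPoints.addSubgroup N M →+ FixedPoints.addSubgroup κ.kerSubgroup M)
      (subOne N M γn).range = (subOne κ.kerSubgroup M (γ ^ p ^ n)).range := by
    ext b
    constructor
    · rintro ⟨x, ⟨y, rfl⟩, rfl⟩
      exact ⟨e y, Subtype.ext rfl⟩
    · rintro ⟨y, rfl⟩
      exact ⟨subOne N M γn (e.symm y), ⟨e.symm y, rfl⟩, Subtype.ext rfl⟩
  let eq : FixedPoints.addSubgroup N M ⧸ (subOne N M γn).range ≃+
      FixedPoints.addSubgroup κ.kerSubgroup M ⧸ (subOne κ.kerSubgroup M (γ ^ p ^ n)).range :=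
    QuotientAddGroup.congr _ _ e he
  haveI : Finite (FixedPoints.addSubgroup N M ⧸ (subOne N M γn).range) :=
    Finite.of_equiv _ eq.toEquiv.symm
  have hcard : Nat.card (FixedPoints.addSubgroup N M ⧸ (subOne N M γn).range) =
      Nat.card (FixedPoints.addSubgroup κ.kerSubgroup M ⧸
        (subOne κ.kerSubgroup M (γ ^ p ^ n)).range) :=
    Nat.card_congr eq.toEquiv
  obtain ⟨-, hcardK⟩ := ResKernel.finite_subgroupResKer N M γn hgen hcont'
  haveI : Finite (subgroupResKer M N) := (ResKernel.finite_subgroupResKer N M γn hgen hcont').1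
  have hker : (resOfLe M (κ.kerSubgroup_le_layerSubgroup n)).ker ≤ subgroupResKer M N := by
    intro c hc
    let j : N →ₜ* κ.kerSubgroup :=
      { toFun := fun x ↦ ⟨((x : Hn) : absoluteGaloisGroup K), Subgroup.mem_subgroupOf.mp x.2⟩
        map_one' := rfl
        map_mul' := fun _ _ ↦ rfl
        continuous_toFun :=
          (continuous_subtype_val.comp continuous_subtype_val).subtype_mk _ }
    have hcomp : (resH1Hom j (AddMonoidHom.id M) (fun _ _ ↦ rfl)).comp
        (resOfLe M (κ.kerSubgroup_le_layerSubgroup n)) = resSubgroup N M := by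
      unfold Literature.NumberTheory.EllipticCurves.resOfLe ResKernel.resSubgroup
      rw [resH1Hom_comp]
      exact resH1Hom_congr (ContinuousMonoidHom.ext fun _ ↦ rfl) (AddMonoidHom.ext fun _ ↦ rfl) _ _
    rw [mem_subgroupResKer_iff, ← hcomp, AddMonoidHom.comp_apply, (AddMonoidHom.mem_ker).mp hc,
      map_zero]
  have hinj := AddSubgroup.inclusion_injective hker
  exact ⟨Finite.of_injective _ hinj,
    (Nat.card_le_card_of_injective _ hinj).trans (hcardK.trans hcard.le)⟩

/-- **KERNEL OF CONTROL**: the kernel of `𝔖_𝔮(K_n, M) → 𝔖_𝔮(K_∞, M)` is finite with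
`# ≤ #(M^{H_∞} ⧸ (γ^{pⁿ} − 1) M^{H_∞})` (it embeds into the kernel of the global restriction map,
`finite_ker_resOfLe_and_card_le`). For `M = W* = E[𝔭*^∞] ≅ ℚ_p/ℤ_p(ψ*)`: `M^{H_∞} = W*(K_∞)`.
[cite: Agboola2007, §3 Prop. 3.2 (arXiv p0008:L128–135, L197)] [cite: GreenbergLNM1716, §3 Lemma 3.1] -/
theorem finite_ker_control_and_card_le {γ : absoluteGaloisGroup K} (hγ : κ.IsTopGenerator γ)
    (hcont : ∀ m : M, Continuous fun g : absoluteGaloisGroup K ↦ g • m)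
    [Finite (FixedPoints.addSubgroup κ.kerSubgroup M ⧸
      (subOne κ.kerSubgroup M (γ ^ p ^ n)).range)] :
    Finite ((resOfLe M (κ.kerSubgroup_le_layerSubgroup n)).comp
        (restrictedSelmer (κ.layerSubgroup n) M p 𝔮).subtype).ker ∧
      Nat.card ((resOfLe M (κ.kerSubgroup_le_layerSubgroup n)).comp
          (restrictedSelmer (κ.layerSubgroup n) M p 𝔮).subtype).ker ≤
        Nat.card (FixedPoints.addSubgroup κ.kerSubgroup M ⧸
          (subOne κ.kerSubgroup M (γ ^ p ^ n)).range) := by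
  obtain ⟨hfin, hle⟩ := finite_ker_resOfLe_and_card_le κ M n hγ hcont
  let ι : ((resOfLe M (κ.kerSubgroup_le_layerSubgroup n)).comp
      (restrictedSelmer (κ.layerSubgroup n) M p 𝔮).subtype).ker →
      (resOfLe M (κ.kerSubgroup_le_layerSubgroup n)).ker :=
    fun c ↦ ⟨(c : restrictedSelmer (κ.layerSubgroup n) M p 𝔮), by
      have h := c.2
      rw [AddMonoidHom.mem_ker, AddMonoidHom.comp_apply] at h
      exact h⟩
  have hι : Function.Injective ι := fun a b hab ↦ by
    have h1 : (ι a).1 = (ι b).1 := congrArg Subtype.val hab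
    exact Subtype.ext (Subtype.ext h1)
  haveI := hfin
  exact ⟨Finite.of_injective ι hι, (Nat.card_le_card_of_injective ι hι).trans hle⟩

/-! ### Cokernel: every `Γ_n`-invariant class lifts, and the obstruction is local -/

/-- **Every `γ^{pⁿ}`-invariant class of `H¹(K_∞, M)` lifts to `H¹(K_n, M)`** for a discrete `p`-primary `M` with
continuous orbit maps (Greenberg's Lemma 3.2 "`Coker(h_n) = 0`", `cd_p ℤ_p = 1`; the tree's generic
`ZpExtension.mem_range_resOfLe_of_conjH1_eq`): the GLOBAL cokernel of control vanishes, so the cokernel of the control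
map on `𝔖_𝔮` is purely LOCAL (`resOfLe_local_lift_eq_zero`). [cite: GreenbergLNM1716, §3 Lemma 3.2 (p. 86)] -/
theorem exists_resOfLe_eq_of_conjH1_eq {γ : absoluteGaloisGroup K} (hγ : κ.IsTopGenerator γ)
    (hcont : ∀ m : M, Continuous fun g : absoluteGaloisGroup K ↦ g • m)
    (hprim : ∀ m : M, ∃ k : ℕ, p ^ k • m = 0) (y : subgroupH1 κ.kerSubgroup M)
    (hy : conjH1 κ.kerSubgroup M (γ ^ p ^ n) y = y) :
    ∃ x : subgroupH1 (κ.layerSubgroup n) M, resOfLe M (κ.kerSubgroup_le_layerSubgroup n) x = y :=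
  ZpExtension.mem_range_resOfLe_of_conjH1_eq κ hγ n hcont hprim y hy

/-- **THE COKERNEL OF CONTROL IS LOCAL**: if `x ∈ H¹(K_n, M)` restricts into `𝔖_𝔮(K_∞, M)`, then for every
`σ ∈ Γ_K` the level-`n` local classes `loc_w (conj_σ x) ∈ H¹(H_n ⊓ D_w, M)` (finite `w ∤ p`, the place `𝔮`) and
`∈ H¹(H_n ⊓ D_w, M)` (infinite `w`) restrict to ZERO on `H_∞ ⊓ D_w` — i.e. they lie in the LOCAL KERNELS
`ker (H¹(H_n ⊓ D_w, M) → H¹(H_∞ ⊓ D_w, M))`, the named abstract local terms of the control theorem (their values —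
`H¹` of the local decomposition groups of `K_∞/K_n` with coefficients in the local points — are local theory, not
here). `x ∈ 𝔖_𝔮(K_n, M)` iff these local classes themselves vanish (`mem_restrictedSelmer_iff_resOfLe`).
[cite: Agboola2007, §3 Prop. 3.2 (arXiv p0008:L128–135, L197: "the exact sequence")] [cite: GreenbergLNM1716, §3 (the maps `r_n`)] -/
theorem resOfLe_local_lift_eq_zero {x : subgroupH1 (κ.layerSubgroup n) M}
    (hx : resOfLe M (κ.kerSubgroup_le_layerSubgroup n) x ∈ restrictedSelmer κ.kerSubgroup M p 𝔮)
    (σ : absoluteGaloisGroup K) :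
    (∀ w : HeightOneSpectrum (𝓞 K), ((p : ℕ) : 𝓞 K) ∉ w.asIdeal →
        resOfLe M (inf_le_inf_right (decomp w) (κ.kerSubgroup_le_layerSubgroup n) :
            κ.kerSubgroup ⊓ decomp w ≤ κ.layerSubgroup n ⊓ decomp w)
          (resOfLe M (inf_le_left : κ.layerSubgroup n ⊓ decomp w ≤ κ.layerSubgroup n)
            (conjH1 (κ.layerSubgroup n) M σ x)) = 0) ∧
      (∀ w : InfinitePlace K,
        resOfLe M (inf_le_inf_right (decompInf w) (κ.kerSubgroup_le_layerSubgroup n) :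
            κ.kerSubgroup ⊓ decompInf w ≤ κ.layerSubgroup n ⊓ decompInf w)
          (resOfLe M (inf_le_left : κ.layerSubgroup n ⊓ decompInf w ≤ κ.layerSubgroup n)
            (conjH1 (κ.layerSubgroup n) M σ x)) = 0) ∧
      resOfLe M (inf_le_inf_right (decomp 𝔮) (κ.kerSubgroup_le_layerSubgroup n) :
          κ.kerSubgroup ⊓ decomp 𝔮 ≤ κ.layerSubgroup n ⊓ decomp 𝔮)
        (resOfLe M (inf_le_left : κ.layerSubgroup n ⊓ decomp 𝔮 ≤ κ.layerSubgroup n)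
          (conjH1 (κ.layerSubgroup n) M σ x)) = 0 := by
  rw [mem_restrictedSelmer_iff_resOfLe] at hx
  have hcomm : conjH1 κ.kerSubgroup M σ (resOfLe M (κ.kerSubgroup_le_layerSubgroup n) x) =
      resOfLe M (κ.kerSubgroup_le_layerSubgroup n) (conjH1 (κ.layerSubgroup n) M σ x) :=
    (congrArg (fun f ↦ f x)
      (resOfLe_comp_conjH1_holds (M := M) (κ.kerSubgroup_le_layerSubgroup n) σ)).symm
  refine ⟨fun w hw ↦ ?_, fun w ↦ ?_, ?_⟩
  · have h := hx.1 w hw σ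
    rwa [hcomm, resOfLe_inf_resOfLe M (κ.kerSubgroup_le_layerSubgroup n)] at h
  · have h := hx.2.1 w σ
    rwa [hcomm, resOfLe_inf_resOfLe M (κ.kerSubgroup_le_layerSubgroup n)] at h
  · have h := hx.2.2 σ
    rwa [hcomm, resOfLe_inf_resOfLe M (κ.kerSubgroup_le_layerSubgroup n)] at h

/-- The image of the control map, unfolded: `y ∈ res(𝔖_𝔮(K_n, M))` iff `y` has a lift `x ∈ H¹(K_n, M)` all of whose
level-`n` local classes vanish (so, with `exists_resOfLe_eq_of_conjH1_eq`, a `Γ_n`-invariant `y ∈ 𝔖_𝔮(K_∞, M)` fails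
to be in the image exactly when NO lift has vanishing local classes — lifts differ by `ker (H¹(K_n) → H¹(K_∞))`,
`finite_ker_resOfLe_and_card_le`). [cite: Agboola2007, §3 Prop. 3.2] -/
theorem mem_map_resOfLe_restrictedSelmer_iff (y : subgroupH1 κ.kerSubgroup M) :
    y ∈ (restrictedSelmer (κ.layerSubgroup n) M p 𝔮).map
        (resOfLe M (κ.kerSubgroup_le_layerSubgroup n)) ↔
      ∃ x : subgroupH1 (κ.layerSubgroup n) M,
        resOfLe M (κ.kerSubgroup_le_layerSubgroup n) x = y ∧
        (∀ w : HeightOneSpectrum (𝓞 K), ((p : ℕ) : 𝓞 K) ∉ w.asIdeal → ∀ σ : absoluteGaloisGroup K,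
            resOfLe M (inf_le_left : κ.layerSubgroup n ⊓ decomp w ≤ κ.layerSubgroup n)
              (conjH1 (κ.layerSubgroup n) M σ x) = 0) ∧
        (∀ (w : InfinitePlace K) (σ : absoluteGaloisGroup K),
            resOfLe M (inf_le_left : κ.layerSubgroup n ⊓ decompInf w ≤ κ.layerSubgroup n)
              (conjH1 (κ.layerSubgroup n) M σ x) = 0) ∧
        ∀ σ : absoluteGaloisGroup K,
            resOfLe M (inf_le_left : κ.layerSubgroup n ⊓ decomp 𝔮 ≤ κ.layerSubgroup n)
              (conjH1 (κ.layerSubgroup n) M σ x) = 0 := by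
  constructor
  · rintro ⟨x, hx, rfl⟩
    exact ⟨x, rfl, (mem_restrictedSelmer_iff_resOfLe _ M p 𝔮 x).1 hx⟩
  · rintro ⟨x, rfl, hx⟩
    exact ⟨x, (mem_restrictedSelmer_iff_resOfLe _ M p 𝔮 x).2 hx, rfl⟩

/-- **SURJECTIVITY CRITERION FOR CONTROL** (onto the `γ^{pⁿ}`-invariants): if every `x ∈ H¹(K_n, M)` whose
restriction lies in `𝔖_𝔮(K_∞, M)` can be corrected, without changing its restriction, to a class satisfying the
level-`n` local conditions (the local kernels of `resOfLe_local_lift_eq_zero` impose no obstruction), then every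
`γ^{pⁿ}`-invariant class of `𝔖_𝔮(K_∞, M)` is a restriction from `𝔖_𝔮(K_n, M)` (global lift by
`exists_resOfLe_eq_of_conjH1_eq`). [cite: Agboola2007, §3 Prop. 3.2] [cite: GreenbergLNM1716, §3 Lemma 3.2] -/
theorem control_surjective_of_local {γ : absoluteGaloisGroup K} (hγ : κ.IsTopGenerator γ)
    (hcont : ∀ m : M, Continuous fun g : absoluteGaloisGroup K ↦ g • m)
    (hprim : ∀ m : M, ∃ k : ℕ, p ^ k • m = 0)
    (hloc : ∀ x : subgroupH1 (κ.layerSubgroup n) M,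
      resOfLe M (κ.kerSubgroup_le_layerSubgroup n) x ∈ restrictedSelmer κ.kerSubgroup M p 𝔮 →
        ∃ x' : subgroupH1 (κ.layerSubgroup n) M,
          resOfLe M (κ.kerSubgroup_le_layerSubgroup n) x' =
            resOfLe M (κ.kerSubgroup_le_layerSubgroup n) x ∧
          x' ∈ restrictedSelmer (κ.layerSubgroup n) M p 𝔮)
    {y : subgroupH1 κ.kerSubgroup M} (hy : y ∈ restrictedSelmer κ.kerSubgroup M p 𝔮)
    (hinv : conjH1 κ.kerSubgroup M (γ ^ p ^ n) y = y) :
    y ∈ (restrictedSelmer (κ.layerSubgroup n) M p 𝔮).map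
        (resOfLe M (κ.kerSubgroup_le_layerSubgroup n)) := by
  obtain ⟨x, rfl⟩ := exists_resOfLe_eq_of_conjH1_eq κ M n hγ hcont hprim y hinv
  obtain ⟨x', hx', hmem⟩ := hloc x hy
  exact ⟨x', hmem, hx'⟩

/-! ### The bottom layer `n = 0`: `H_0 = ⊤` and `𝔖_𝔮(K_0, M) = 𝔖_𝔮(K, M)` -/

omit [NumberField K] in
/-- At the bottom `n = 0`, `H_0 = κ.layerSubgroup 0 = ⊤` (`ZpExtension.layerSubgroup_zero`) and the restriction
`H¹(⊤, M) → H¹(H_0, M)` is invertible (its inverse is the restriction along `⊤ ≤ H_0`; `resOfLe_comp`,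
`resOfLe_refl`). [cite: NeukirchSchmidtWingberg2008, I.§5] -/
theorem resOfLe_layer_zero_leftInverse :
    Function.LeftInverse (resOfLe M (le_of_eq (ZpExtension.layerSubgroup_zero κ).symm))
      (resOfLe M (le_top : κ.layerSubgroup 0 ≤ ⊤)) := by
  intro c
  rw [← AddMonoidHom.comp_apply, resOfLe_comp_holds, resOfLe_refl_holds, AddMonoidHom.id_apply]

/-- **The bottom of the control map is Agboola's `𝔖_𝔮(K, M)`**: restriction along `H_0 ≤ ⊤` maps
`Agboola2007.restrictedSelmerBase M p 𝔮` (file 2 of the pair skeleton) ONTO `𝔖_𝔮(K_0, M) = restrictedSelmer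
(κ.layerSubgroup 0) M p 𝔮`, injectively (`resOfLe_layer_zero_leftInverse`) — so the layer-`0` control statements
above are statements about `𝔖_𝔮(K, M) → 𝔖_𝔮(K_∞, M)^Γ`. [cite: Agboola2007, §6 (arXiv p0013:L1–4), §3 Prop. 3.2] -/
theorem map_resOfLe_restrictedSelmerBase_eq_layer_zero :
    (restrictedSelmerBase M p 𝔮).map (resOfLe M (le_top : κ.layerSubgroup 0 ≤ ⊤)) =
      restrictedSelmer (κ.layerSubgroup 0) M p 𝔮 := by
  refine le_antisymm (map_resOfLe_restrictedSelmer_le M p 𝔮 le_top) fun c hc ↦ ?_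
  refine ⟨resOfLe M (le_of_eq (ZpExtension.layerSubgroup_zero κ).symm) c,
    resOfLe_mem_restrictedSelmer M p 𝔮 _ hc, ?_⟩
  rw [← AddMonoidHom.comp_apply, resOfLe_comp_holds, resOfLe_refl_holds, AddMonoidHom.id_apply]

/-- `#𝔖_𝔮(K_0, M) = #𝔖_𝔮(K, M)` (the bijection of `map_resOfLe_restrictedSelmerBase_eq_layer_zero`; `Nat.card`).
[cite: Agboola2007, §6 (arXiv p0013:L1–4)] -/
theorem card_restrictedSelmer_layer_zero_eq :
    Nat.card (restrictedSelmer (κ.layerSubgroup 0) M p 𝔮) = Nat.card (restrictedSelmerBase M p 𝔮) := by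
  rw [← map_resOfLe_restrictedSelmerBase_eq_layer_zero κ M 𝔮]
  exact AddSubgroup.card_map_of_injective (resOfLe_layer_zero_leftInverse κ M).injective

end Control

end Summit.BirchSwinnertonDyer.BirchSwinnertonDyer.Theorems.PrintCf2.RestrictedSelmerPair

end
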